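import Summits.BirchSwinnertonDyer.BirchSwinnertonDyer.Theorems.QuadraticBranchSignedControlPlusEtaR1TamagawaRowShape
import Summits.BirchSwinnertonDyer.BirchSwinnertonDyer.Theorems.Rank1ResidualX11RankOneMinimality
import Summits.BirchSwinnertonDyer.Rank1Residual.Additive.IntModelTamagawaCertificate
import HarnessLib

/-!
# Route `QuadraticBranchSignedControl` (rung K8, cell `bsd-potss`), crux `PlusEtaLowerInclusion`
# (item stmt-BirchSwinnertonDyer-19601): the RANK-ONE TAMAGAWA ROWS, part 01 — (E⁺_η) ∧ (C1⁺_η) at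
# `p = 5` for every tower-onto good supersingular twist of each listed additive partner `W`, the two
# Tamagawa-`5` primes of `W` CERTIFIED IN THE KERNEL (seat `bsd-potss-k8eta-c1` g4; `--supports` 19601)

WHAT. g3's census (HOME/k8eta-c1/ETALEAD-TABLE-k8eta-c1-g3.tsv) lists 13 rank-one tower-onto rows of crux
19601 with `v_an = 1` and EXACTLY two Tamagawa-`5` primes `5 ∥ c_ℓ(W)`. The Tamagawa road (this seat:
`…TamagawaRoadCount` p513046, `…Duality` p514033, `…TamagawaRoad` p515151, record shape
`…PlusEtaR1TamagawaRowShape`) gives (E⁺_η)(V,5) ∧ (C1⁺_η)(V,5) at such a pair from the named facts, the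
`V`-side certificates and the arithmetic input `1 + rank W ≤ ∑ ord₅ c_ℓ(W) = 2`. THIS FILE instantiates
it per row: for each `W` (Cremona's minimal model) the rank-2 observatory's Tate-algorithm ROW CERTIFICATE
(`TamLocal.rowCheck`, kinds: `1` split multiplicative with a node-tangent root witness, `2`/`3` non-split,
`4`/`5` Tate certificates at additive primes; complete by `|Δ| = ∏ ℓⁿ`) is checked by `decide +kernel`,
global minimality by the bounded Kraus criterion, and `etaPair_of_rowCheck_of_tamagawaPair` is applied with
the two Tamagawa-`5` primes as `L`. Certificates: the observatory's engine
(`b2b/bsd-rank2-observatory/b2b-bsdr2-cert-2/kernel-tam3/engine1/tam.py`, unmodified) on the models of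
g3's `TAMAGAWA-40-k8eta-c1-g3.txt` (PARI), values cross-checked against PARI's `elllocalred`.

HONEST LABEL (cell `bsd-potss`, HUMAN RULING D-0036/D-0074/D-0088(2)): every row theorem is CONDITIONAL on
NAMED facts in hypothesis position (Kobayashi 2003 Thm. 1.2/1.3/2.2η/4.1η, Kitajima–Otsuki 2018 Thm. 1.3 at
`η`, Poitou–Tate = Milne I.4.10) and on DISPLAYED per-pair inputs: `rank W(ℚ) ≤ 1` (GZK on these
analytic-rank-one rows — NOT proved here), and on the twist `V`: `ρ_{V,5^m}` onto for all `m`, the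
`V`-certificate, and the ANALYTIC certificate `25 ∤ coeff₁ L_5⁺(V,η,T)` (g3's kit census: `v_an = 1`;
EVIDENCE tier, kernel for NO row). IN THE KERNEL per row: `Δ ≠ 0`, global minimality, the complete local
Tamagawa data of `W` at every bad prime. These are PER-ROW INSTANCES; the class-wide crux 19601 is OPEN and
NOT closed; nothing is booked; `BSD(W,5)` is claimed for no row. No `sorry`, no definition, axioms standard.

References: [Kobayashi2003] §4 Even MC + Thm. 4.1 (p. 8), Thm. 2.2 (p. 5); [KitajimaOtsuki2018] Thm. 1.3;
[MilneADT2006] I Thm. 4.10; [SilvermanATAEC1994] IV.9.4; [Cremona1997] Table 1; [Kraus1989].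
-/

set_option autoImplicit false
set_option linter.dupNamespace false

noncomputable section

open scoped Classical

open CongruenceSubgroup WeierstrassCurve
open Literature.NumberTheory.EllipticCurves
open Literature.NumberTheory.EllipticCurves.ModularForms
open Literature.NumberTheory.GaloisRepresentations
open Literature.NumberTheory.GaloisCohomology
open Summit.BirchSwinnertonDyer.Rank1Residual.Additive
open Summit.BirchSwinnertonDyer.BirchSwinnertonDyer.Rank2Observatory.Tam
open Summit.BirchSwinnertonDyer.BirchSwinnertonDyer.Rank1Residual.X11RankOne

namespace Summit.BirchSwinnertonDyer.BirchSwinnertonDyer.Theorems.PlusEtaR1TamagawaRows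


/-! ### `W = 33150cf1` -/

/-- The kernel ROW CERTIFICATE of `W = 33150cf1` (`[1, 0, 0, -477763, -122897983]`): `2`: In `n = 10`, kind 1 (split, root witness), `c = 10`; `3`: In `n = 10`, kind 1 (split, root witness), `c = 10`; `5`: I0* `n = 6`, kind 5 (deep Tate cert), `c = 2` (certified set [1, 2, 4]); `13`: In `n = 4`, kind 1 (split, root witness), `c = 4`; `17`: In `n = 1`, kind 1 (split, root witness), `c = 1`; complete (`|Δ| = ∏ ℓⁿ`).
Engine `tam.py` (rank-2 observatory) unmodified; checked by `decide +kernel`. [cite: SilvermanATAEC1994, IV.9.4] [cite: Cremona1997, Table 1 (label 33150cf1)] -/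
theorem rowCheck_v33150cf1 : TamLocal.rowCheck [⟨2, 1, 1, 0, 0, 0, 0, 10, 0, 0, 10⟩, ⟨3, 1, 1, 0, 0, 0, 0, 10, 0, 0, 10⟩, ⟨5, 2, 5, 0, 2, 2, 24, 6, 6, 0, 2⟩, ⟨13, 3, 1, 0, 0, 0, 0, 4, 0, 0, 4⟩, ⟨17, 4, 1, 4, 0, 0, 0, 1, 0, 0, 1⟩] ⟨1, 0, 0, (-477763), (-122897983)⟩ = true := by
  decide +kernel

set_option maxRecDepth 100000 in
/-- `W = 33150cf1` (`[1, 0, 0, -477763, -122897983]`) is a GLOBAL MINIMAL equation (bounded Kraus criterion on the literal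
coefficients). [cite: Kraus1989] [cite: SilvermanAEC2009, VII.1 Remark 1.1] -/
theorem isGloballyMinimal_v33150cf1 : (⟨1, 0, 0, (-477763), (-122897983)⟩ : WeierstrassCurve ℚ).IsGloballyMinimal :=
  isGloballyMinimal_of_krausCriterion_bounded 1 0 0 (-477763) (-122897983)
    (by decide +kernel) (by decide +kernel) (by decide +kernel)

/-- **(E⁺_η) ∧ (C1⁺_η) at `p = 5` for EVERY tower-onto good supersingular twist of `W = 33150cf1`** (Cremona's minimal
model `[1, 0, 0, -477763, -122897983]`, additive `I₀*` at `5`; its minimal `5`-twist `V` has conductor `1326`, good supersingular with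
`a_5(V) = 0`, `ρ_{V,5^∞}` onto, `r_an = 1` — a RANK-ONE TOWER-ONTO row of crux 19601's census; Tamagawa-`5`
primes `2:10, 3:10`, `v_an = 1` in g3's table). IN THE KERNEL: `Δ ≠ 0`, global minimality, the local Tamagawa
numbers of `W` at every bad prime (`rowCheck_v33150cf1`), hence `∑_T ord₅ c_ℓ(W) = 2` on `T = {2, 3}` and
`5 ∤ c_ℓ(W)` at every other `ℓ ≠ 5`. DISPLAYED: `rank W(ℚ) ≤ 1`; on `V`: tower onto, the `V`-certificate,
the analytic certificate `25 ∤ coeff₁ L_5⁺(V,η,T)`. CONDITIONAL on the named facts; a per-row instance; nothing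
booked; `BSD(W,5)` not claimed. [cite: Kobayashi2003, §4 Even main conjecture and Thm. 4.1 (p. 8)]
[cite: KitajimaOtsuki2018, Thm. 1.3] [cite: MilneADT2006, Ch. I, Thm. 4.10] [cite: Cremona1997, Table 1 (label 33150cf1)] -/
theorem etaPair_r1_v33150cf1_5
    (h12 : Kobayashi2003.thm12_signedSelmerDual_finite_torsion)
    (h13 : Kobayashi2003.thm41_signedCharIdeal_divisibility)
    (h22 : Kobayashi2003.thm22_etaSignedSelmerDual_finite_torsion)
    (h41 : Kobayashi2003.thm41_plusEtaCharIdeal_dvd)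
    (hKO : KitajimaOtsuki2018.mainThm13_etaSignedSelmerDual_noFiniteSubmodule)
    (hPT : poitouTate_selmerStructure_duality_real ℚ)
    (W : WeierstrassCurve ℚ) (hW : W = ⟨1, 0, 0, (-477763), (-122897983)⟩)
    (hrW : W.mordellWeilRank ≤ 1)
    (V : WeierstrassCurve ℚ) [V.IsElliptic] [V.IsGloballyMinimal] [Fact (5 : ℕ).Prime]
    (C : VariableChange ℚ) (hCV : C • W.quadraticTwist 5 = V)
    (hgood : V.HasGoodReductionAtPrime 5) (hap : V.frobeniusTrace 5 = 0)
    (hsurj : ∀ m : ℕ, V.HasSurjectiveModNGaloisRep (5 ^ m : ℕ))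
    (hcertV : ∀ {N : ℕ} [NeZero N] (f : CuspForm (Gamma0 N) 2), IsNewformOf V f →
      ∃ L : IwasawaAlgebra 5, Kobayashi2003.IsSignedPAdicLFunction f 5 1 L ∧
        IsUnit (PowerSeries.coeff V.mordellWeilRank L))
    (han : ∀ {N : ℕ} [NeZero N] {f : CuspForm (Gamma0 N) 2}, IsNewformOf V f →
      ∀ (ϖ : ℚ), (if Even (5 / 2) then (ϖ : ℝ) * V.realPeriodRat = plusPeriod f
          else (ϖ : ℝ) * V.imaginaryPeriodRat = minusPeriod f) →
      ∀ (Lη : IwasawaAlgebra 5), IsQuadraticBranchPlusLFunction f 5 ϖ Lη →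
        ¬ (5 : ℤ_[5]) ^ 2 ∣ PowerSeries.coeff (V.quadraticTwist 5).mordellWeilRank Lη) :
    QuadraticBranchPlusEtaLowerInclusionAt V 5 ∧ QuadraticBranchPlusEtaMainConjectureAt V 5 := by
  subst hW
  have hb := IntModelTam.baseChange_rat_mk_int 1 0 0 (-477763) (-122897983)
  haveI : ((⟨1, 0, 0, (-477763), (-122897983)⟩ : WeierstrassCurve ℤ).baseChange ℚ).IsElliptic := TamLocal.isElliptic_of_rowCheck rowCheck_v33150cf1
  haveI : ((⟨1, 0, 0, (-477763), (-122897983)⟩ : WeierstrassCurve ℤ).baseChange ℚ).IsGloballyMinimal := by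
    rw [hb]; exact isGloballyMinimal_v33150cf1
  have hD : ((-1 : ℚ) ^ ((5 : ℕ) / 2) * ((5 : ℕ) : ℚ)) = 5 := by norm_num
  refine etaPair_of_rowCheck_of_tamagawaPair h12 h13 h22 h41 hKO hPT (le_refl 5) rowCheck_v33150cf1
    [2, 3] (by decide) (by decide) (by decide) (by decide) (by decide) rfl (hrW := by rw [hb]; exact hrW) V C
    (by rw [hb, hD]; exact hCV) hgood hap hsurj (fun f hf => hcertV f hf) ?_
  intro N _ f hf ϖ hϖ Lη hL
  rw [hD]
  exact han hf ϖ hϖ Lη hL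

/-! ### `W = 36075p1` -/

/-- The kernel ROW CERTIFICATE of `W = 36075p1` (`[0, 1, 1, -8333, 451619]`): `3`: In `n = 5`, kind 1 (split, root witness), `c = 5`; `5`: I0* `n = 6`, kind 5 (deep Tate cert), `c = 2` (certified set [1, 2, 4]); `13`: In `n = 5`, kind 1 (split, root witness), `c = 5`; `37`: In `n = 1`, kind 3 (non-split, Euler witness), `c = 1`; complete (`|Δ| = ∏ ℓⁿ`).
Engine `tam.py` (rank-2 observatory) unmodified; checked by `decide +kernel`. [cite: SilvermanATAEC1994, IV.9.4] [cite: Cremona1997, Table 1 (label 36075p1)] -/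
theorem rowCheck_v36075p1 : TamLocal.rowCheck [⟨3, 1, 1, 2, 0, 0, 0, 5, 0, 0, 5⟩, ⟨5, 2, 5, 0, 3, 0, 12, 6, 6, 0, 2⟩, ⟨13, 3, 1, 8, 0, 0, 0, 5, 0, 0, 5⟩, ⟨37, 6, 3, 0, 0, 0, 0, 1, 0, 0, 1⟩] ⟨0, 1, 1, (-8333), 451619⟩ = true := by
  decide +kernel

set_option maxRecDepth 100000 in
/-- `W = 36075p1` (`[0, 1, 1, -8333, 451619]`) is a GLOBAL MINIMAL equation (bounded Kraus criterion on the literal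
coefficients). [cite: Kraus1989] [cite: SilvermanAEC2009, VII.1 Remark 1.1] -/
theorem isGloballyMinimal_v36075p1 : (⟨0, 1, 1, (-8333), 451619⟩ : WeierstrassCurve ℚ).IsGloballyMinimal :=
  isGloballyMinimal_of_krausCriterion_bounded 0 1 1 (-8333) 451619
    (by decide +kernel) (by decide +kernel) (by decide +kernel)

/-- **(E⁺_η) ∧ (C1⁺_η) at `p = 5` for EVERY tower-onto good supersingular twist of `W = 36075p1`** (Cremona's minimal
model `[0, 1, 1, -8333, 451619]`, additive `I₀*` at `5`; its minimal `5`-twist `V` has conductor `1443`, good supersingular with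
`a_5(V) = 0`, `ρ_{V,5^∞}` onto, `r_an = 1` — a RANK-ONE TOWER-ONTO row of crux 19601's census; Tamagawa-`5`
primes `3:5, 13:5`, `v_an = 1` in g3's table). IN THE KERNEL: `Δ ≠ 0`, global minimality, the local Tamagawa
numbers of `W` at every bad prime (`rowCheck_v36075p1`), hence `∑_T ord₅ c_ℓ(W) = 2` on `T = {3, 13}` and
`5 ∤ c_ℓ(W)` at every other `ℓ ≠ 5`. DISPLAYED: `rank W(ℚ) ≤ 1`; on `V`: tower onto, the `V`-certificate,
the analytic certificate `25 ∤ coeff₁ L_5⁺(V,η,T)`. CONDITIONAL on the named facts; a per-row instance; nothing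
booked; `BSD(W,5)` not claimed. [cite: Kobayashi2003, §4 Even main conjecture and Thm. 4.1 (p. 8)]
[cite: KitajimaOtsuki2018, Thm. 1.3] [cite: MilneADT2006, Ch. I, Thm. 4.10] [cite: Cremona1997, Table 1 (label 36075p1)] -/
theorem etaPair_r1_v36075p1_5
    (h12 : Kobayashi2003.thm12_signedSelmerDual_finite_torsion)
    (h13 : Kobayashi2003.thm41_signedCharIdeal_divisibility)
    (h22 : Kobayashi2003.thm22_etaSignedSelmerDual_finite_torsion)
    (h41 : Kobayashi2003.thm41_plusEtaCharIdeal_dvd)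
    (hKO : KitajimaOtsuki2018.mainThm13_etaSignedSelmerDual_noFiniteSubmodule)
    (hPT : poitouTate_selmerStructure_duality_real ℚ)
    (W : WeierstrassCurve ℚ) (hW : W = ⟨0, 1, 1, (-8333), 451619⟩)
    (hrW : W.mordellWeilRank ≤ 1)
    (V : WeierstrassCurve ℚ) [V.IsElliptic] [V.IsGloballyMinimal] [Fact (5 : ℕ).Prime]
    (C : VariableChange ℚ) (hCV : C • W.quadraticTwist 5 = V)
    (hgood : V.HasGoodReductionAtPrime 5) (hap : V.frobeniusTrace 5 = 0)
    (hsurj : ∀ m : ℕ, V.HasSurjectiveModNGaloisRep (5 ^ m : ℕ))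
    (hcertV : ∀ {N : ℕ} [NeZero N] (f : CuspForm (Gamma0 N) 2), IsNewformOf V f →
      ∃ L : IwasawaAlgebra 5, Kobayashi2003.IsSignedPAdicLFunction f 5 1 L ∧
        IsUnit (PowerSeries.coeff V.mordellWeilRank L))
    (han : ∀ {N : ℕ} [NeZero N] {f : CuspForm (Gamma0 N) 2}, IsNewformOf V f →
      ∀ (ϖ : ℚ), (if Even (5 / 2) then (ϖ : ℝ) * V.realPeriodRat = plusPeriod f
          else (ϖ : ℝ) * V.imaginaryPeriodRat = minusPeriod f) →
      ∀ (Lη : IwasawaAlgebra 5), IsQuadraticBranchPlusLFunction f 5 ϖ Lη →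
        ¬ (5 : ℤ_[5]) ^ 2 ∣ PowerSeries.coeff (V.quadraticTwist 5).mordellWeilRank Lη) :
    QuadraticBranchPlusEtaLowerInclusionAt V 5 ∧ QuadraticBranchPlusEtaMainConjectureAt V 5 := by
  subst hW
  have hb := IntModelTam.baseChange_rat_mk_int 0 1 1 (-8333) 451619
  haveI : ((⟨0, 1, 1, (-8333), 451619⟩ : WeierstrassCurve ℤ).baseChange ℚ).IsElliptic := TamLocal.isElliptic_of_rowCheck rowCheck_v36075p1
  haveI : ((⟨0, 1, 1, (-8333), 451619⟩ : WeierstrassCurve ℤ).baseChange ℚ).IsGloballyMinimal := by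
    rw [hb]; exact isGloballyMinimal_v36075p1
  have hD : ((-1 : ℚ) ^ ((5 : ℕ) / 2) * ((5 : ℕ) : ℚ)) = 5 := by norm_num
  refine etaPair_of_rowCheck_of_tamagawaPair h12 h13 h22 h41 hKO hPT (le_refl 5) rowCheck_v36075p1
    [3, 13] (by decide) (by decide) (by decide) (by decide) (by decide) rfl (hrW := by rw [hb]; exact hrW) V C
    (by rw [hb, hD]; exact hCV) hgood hap hsurj (fun f hf => hcertV f hf) ?_
  intro N _ f hf ϖ hϖ Lη hL
  rw [hD]
  exact han hf ϖ hϖ Lη hL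

/-! ### `W = 48300w1` -/

/-- The kernel ROW CERTIFICATE of `W = 48300w1` (`[0, 1, 0, -6333, 950463]`): `2`: IV* `n = 8`, kind 5 (deep Tate cert), `c = 3` (certified set [1, 3]); `3`: In `n = 5`, kind 1 (split, root witness), `c = 5`; `5`: I0* `n = 6`, kind 5 (deep Tate cert), `c = 2` (certified set [1, 2, 4]); `7`: In `n = 5`, kind 1 (split, root witness), `c = 5`; `23`: In `n = 1`, kind 1 (split, root witness), `c = 1`; complete (`|Δ| = ∏ ℓⁿ`).
Engine `tam.py` (rank-2 observatory) unmodified; checked by `decide +kernel`. [cite: SilvermanATAEC1994, IV.9.4] [cite: Cremona1997, Table 1 (label 48300w1)] -/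
theorem rowCheck_v48300w1 : TamLocal.rowCheck [⟨2, 1, 5, 0, 1, 0, 2, 8, 8, 0, 3⟩, ⟨3, 1, 1, 2, 0, 0, 0, 5, 0, 0, 5⟩, ⟨5, 2, 5, 0, 3, 0, 0, 6, 6, 0, 2⟩, ⟨7, 2, 1, 2, 0, 0, 0, 5, 0, 0, 5⟩, ⟨23, 4, 1, 8, 0, 0, 0, 1, 0, 0, 1⟩] ⟨0, 1, 0, (-6333), 950463⟩ = true := by
  decide +kernel

set_option maxRecDepth 100000 in
/-- `W = 48300w1` (`[0, 1, 0, -6333, 950463]`) is a GLOBAL MINIMAL equation (bounded Kraus criterion on the literal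
coefficients). [cite: Kraus1989] [cite: SilvermanAEC2009, VII.1 Remark 1.1] -/
theorem isGloballyMinimal_v48300w1 : (⟨0, 1, 0, (-6333), 950463⟩ : WeierstrassCurve ℚ).IsGloballyMinimal :=
  isGloballyMinimal_of_krausCriterion_bounded 0 1 0 (-6333) 950463
    (by decide +kernel) (by decide +kernel) (by decide +kernel)

/-- **(E⁺_η) ∧ (C1⁺_η) at `p = 5` for EVERY tower-onto good supersingular twist of `W = 48300w1`** (Cremona's minimal
model `[0, 1, 0, -6333, 950463]`, additive `I₀*` at `5`; its minimal `5`-twist `V` has conductor `1932`, good supersingular with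
`a_5(V) = 0`, `ρ_{V,5^∞}` onto, `r_an = 1` — a RANK-ONE TOWER-ONTO row of crux 19601's census; Tamagawa-`5`
primes `3:5, 7:5`, `v_an = 1` in g3's table). IN THE KERNEL: `Δ ≠ 0`, global minimality, the local Tamagawa
numbers of `W` at every bad prime (`rowCheck_v48300w1`), hence `∑_T ord₅ c_ℓ(W) = 2` on `T = {3, 7}` and
`5 ∤ c_ℓ(W)` at every other `ℓ ≠ 5`. DISPLAYED: `rank W(ℚ) ≤ 1`; on `V`: tower onto, the `V`-certificate,
the analytic certificate `25 ∤ coeff₁ L_5⁺(V,η,T)`. CONDITIONAL on the named facts; a per-row instance; nothing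
booked; `BSD(W,5)` not claimed. [cite: Kobayashi2003, §4 Even main conjecture and Thm. 4.1 (p. 8)]
[cite: KitajimaOtsuki2018, Thm. 1.3] [cite: MilneADT2006, Ch. I, Thm. 4.10] [cite: Cremona1997, Table 1 (label 48300w1)] -/
theorem etaPair_r1_v48300w1_5
    (h12 : Kobayashi2003.thm12_signedSelmerDual_finite_torsion)
    (h13 : Kobayashi2003.thm41_signedCharIdeal_divisibility)
    (h22 : Kobayashi2003.thm22_etaSignedSelmerDual_finite_torsion)
    (h41 : Kobayashi2003.thm41_plusEtaCharIdeal_dvd)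
    (hKO : KitajimaOtsuki2018.mainThm13_etaSignedSelmerDual_noFiniteSubmodule)
    (hPT : poitouTate_selmerStructure_duality_real ℚ)
    (W : WeierstrassCurve ℚ) (hW : W = ⟨0, 1, 0, (-6333), 950463⟩)
    (hrW : W.mordellWeilRank ≤ 1)
    (V : WeierstrassCurve ℚ) [V.IsElliptic] [V.IsGloballyMinimal] [Fact (5 : ℕ).Prime]
    (C : VariableChange ℚ) (hCV : C • W.quadraticTwist 5 = V)
    (hgood : V.HasGoodReductionAtPrime 5) (hap : V.frobeniusTrace 5 = 0)
    (hsurj : ∀ m : ℕ, V.HasSurjectiveModNGaloisRep (5 ^ m : ℕ))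
    (hcertV : ∀ {N : ℕ} [NeZero N] (f : CuspForm (Gamma0 N) 2), IsNewformOf V f →
      ∃ L : IwasawaAlgebra 5, Kobayashi2003.IsSignedPAdicLFunction f 5 1 L ∧
        IsUnit (PowerSeries.coeff V.mordellWeilRank L))
    (han : ∀ {N : ℕ} [NeZero N] {f : CuspForm (Gamma0 N) 2}, IsNewformOf V f →
      ∀ (ϖ : ℚ), (if Even (5 / 2) then (ϖ : ℝ) * V.realPeriodRat = plusPeriod f
          else (ϖ : ℝ) * V.imaginaryPeriodRat = minusPeriod f) →
      ∀ (Lη : IwasawaAlgebra 5), IsQuadraticBranchPlusLFunction f 5 ϖ Lη →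
        ¬ (5 : ℤ_[5]) ^ 2 ∣ PowerSeries.coeff (V.quadraticTwist 5).mordellWeilRank Lη) :
    QuadraticBranchPlusEtaLowerInclusionAt V 5 ∧ QuadraticBranchPlusEtaMainConjectureAt V 5 := by
  subst hW
  have hb := IntModelTam.baseChange_rat_mk_int 0 1 0 (-6333) 950463
  haveI : ((⟨0, 1, 0, (-6333), 950463⟩ : WeierstrassCurve ℤ).baseChange ℚ).IsElliptic := TamLocal.isElliptic_of_rowCheck rowCheck_v48300w1
  haveI : ((⟨0, 1, 0, (-6333), 950463⟩ : WeierstrassCurve ℤ).baseChange ℚ).IsGloballyMinimal := by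
    rw [hb]; exact isGloballyMinimal_v48300w1
  have hD : ((-1 : ℚ) ^ ((5 : ℕ) / 2) * ((5 : ℕ) : ℚ)) = 5 := by norm_num
  refine etaPair_of_rowCheck_of_tamagawaPair h12 h13 h22 h41 hKO hPT (le_refl 5) rowCheck_v48300w1
    [3, 7] (by decide) (by decide) (by decide) (by decide) (by decide) rfl (hrW := by rw [hb]; exact hrW) V C
    (by rw [hb, hD]; exact hCV) hgood hap hsurj (fun f hf => hcertV f hf) ?_
  intro N _ f hf ϖ hϖ Lη hL
  rw [hD]
  exact han hf ϖ hϖ Lη hL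

/-! ### `W = 77350bi1` -/

/-- The kernel ROW CERTIFICATE of `W = 77350bi1` (`[1, 1, 1, -36138, 2655031]`): `2`: In `n = 10`, kind 1 (split, root witness), `c = 10`; `5`: I0* `n = 6`, kind 5 (deep Tate cert), `c = 2` (certified set [1, 2, 4]); `7`: In `n = 5`, kind 1 (split, root witness), `c = 5`; `13`: In `n = 1`, kind 1 (split, root witness), `c = 1`; `17`: In `n = 1`, kind 1 (split, root witness), `c = 1`; complete (`|Δ| = ∏ ℓⁿ`).
Engine `tam.py` (rank-2 observatory) unmodified; checked by `decide +kernel`. [cite: SilvermanATAEC1994, IV.9.4] [cite: Cremona1997, Table 1 (label 77350bi1)] -/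
theorem rowCheck_v77350bi1 : TamLocal.rowCheck [⟨2, 1, 1, 0, 0, 0, 0, 10, 0, 0, 10⟩, ⟨5, 2, 5, 0, 0, 2, 12, 6, 6, 0, 2⟩, ⟨7, 2, 1, 5, 0, 0, 0, 5, 0, 0, 5⟩, ⟨13, 3, 1, 3, 0, 0, 0, 1, 0, 0, 1⟩, ⟨17, 4, 1, 15, 0, 0, 0, 1, 0, 0, 1⟩] ⟨1, 1, 1, (-36138), 2655031⟩ = true := by
  decide +kernel

set_option maxRecDepth 100000 in
/-- `W = 77350bi1` (`[1, 1, 1, -36138, 2655031]`) is a GLOBAL MINIMAL equation (bounded Kraus criterion on the literal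
coefficients). [cite: Kraus1989] [cite: SilvermanAEC2009, VII.1 Remark 1.1] -/
theorem isGloballyMinimal_v77350bi1 : (⟨1, 1, 1, (-36138), 2655031⟩ : WeierstrassCurve ℚ).IsGloballyMinimal :=
  isGloballyMinimal_of_krausCriterion_bounded 1 1 1 (-36138) 2655031
    (by decide +kernel) (by decide +kernel) (by decide +kernel)

/-- **(E⁺_η) ∧ (C1⁺_η) at `p = 5` for EVERY tower-onto good supersingular twist of `W = 77350bi1`** (Cremona's minimal
model `[1, 1, 1, -36138, 2655031]`, additive `I₀*` at `5`; its minimal `5`-twist `V` has conductor `3094`, good supersingular with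
`a_5(V) = 0`, `ρ_{V,5^∞}` onto, `r_an = 1` — a RANK-ONE TOWER-ONTO row of crux 19601's census; Tamagawa-`5`
primes `2:10, 7:5`, `v_an = 1` in g3's table). IN THE KERNEL: `Δ ≠ 0`, global minimality, the local Tamagawa
numbers of `W` at every bad prime (`rowCheck_v77350bi1`), hence `∑_T ord₅ c_ℓ(W) = 2` on `T = {2, 7}` and
`5 ∤ c_ℓ(W)` at every other `ℓ ≠ 5`. DISPLAYED: `rank W(ℚ) ≤ 1`; on `V`: tower onto, the `V`-certificate,
the analytic certificate `25 ∤ coeff₁ L_5⁺(V,η,T)`. CONDITIONAL on the named facts; a per-row instance; nothing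
booked; `BSD(W,5)` not claimed. [cite: Kobayashi2003, §4 Even main conjecture and Thm. 4.1 (p. 8)]
[cite: KitajimaOtsuki2018, Thm. 1.3] [cite: MilneADT2006, Ch. I, Thm. 4.10] [cite: Cremona1997, Table 1 (label 77350bi1)] -/
theorem etaPair_r1_v77350bi1_5
    (h12 : Kobayashi2003.thm12_signedSelmerDual_finite_torsion)
    (h13 : Kobayashi2003.thm41_signedCharIdeal_divisibility)
    (h22 : Kobayashi2003.thm22_etaSignedSelmerDual_finite_torsion)
    (h41 : Kobayashi2003.thm41_plusEtaCharIdeal_dvd)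
    (hKO : KitajimaOtsuki2018.mainThm13_etaSignedSelmerDual_noFiniteSubmodule)
    (hPT : poitouTate_selmerStructure_duality_real ℚ)
    (W : WeierstrassCurve ℚ) (hW : W = ⟨1, 1, 1, (-36138), 2655031⟩)
    (hrW : W.mordellWeilRank ≤ 1)
    (V : WeierstrassCurve ℚ) [V.IsElliptic] [V.IsGloballyMinimal] [Fact (5 : ℕ).Prime]
    (C : VariableChange ℚ) (hCV : C • W.quadraticTwist 5 = V)
    (hgood : V.HasGoodReductionAtPrime 5) (hap : V.frobeniusTrace 5 = 0)
    (hsurj : ∀ m : ℕ, V.HasSurjectiveModNGaloisRep (5 ^ m : ℕ))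
    (hcertV : ∀ {N : ℕ} [NeZero N] (f : CuspForm (Gamma0 N) 2), IsNewformOf V f →
      ∃ L : IwasawaAlgebra 5, Kobayashi2003.IsSignedPAdicLFunction f 5 1 L ∧
        IsUnit (PowerSeries.coeff V.mordellWeilRank L))
    (han : ∀ {N : ℕ} [NeZero N] {f : CuspForm (Gamma0 N) 2}, IsNewformOf V f →
      ∀ (ϖ : ℚ), (if Even (5 / 2) then (ϖ : ℝ) * V.realPeriodRat = plusPeriod f
          else (ϖ : ℝ) * V.imaginaryPeriodRat = minusPeriod f) →
      ∀ (Lη : IwasawaAlgebra 5), IsQuadraticBranchPlusLFunction f 5 ϖ Lη →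
        ¬ (5 : ℤ_[5]) ^ 2 ∣ PowerSeries.coeff (V.quadraticTwist 5).mordellWeilRank Lη) :
    QuadraticBranchPlusEtaLowerInclusionAt V 5 ∧ QuadraticBranchPlusEtaMainConjectureAt V 5 := by
  subst hW
  have hb := IntModelTam.baseChange_rat_mk_int 1 1 1 (-36138) 2655031
  haveI : ((⟨1, 1, 1, (-36138), 2655031⟩ : WeierstrassCurve ℤ).baseChange ℚ).IsElliptic := TamLocal.isElliptic_of_rowCheck rowCheck_v77350bi1
  haveI : ((⟨1, 1, 1, (-36138), 2655031⟩ : WeierstrassCurve ℤ).baseChange ℚ).IsGloballyMinimal := by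
    rw [hb]; exact isGloballyMinimal_v77350bi1
  have hD : ((-1 : ℚ) ^ ((5 : ℕ) / 2) * ((5 : ℕ) : ℚ)) = 5 := by norm_num
  refine etaPair_of_rowCheck_of_tamagawaPair h12 h13 h22 h41 hKO hPT (le_refl 5) rowCheck_v77350bi1
    [2, 7] (by decide) (by decide) (by decide) (by decide) (by decide) rfl (hrW := by rw [hb]; exact hrW) V C
    (by rw [hb, hD]; exact hCV) hgood hap hsurj (fun f hf => hcertV f hf) ?_
  intro N _ f hf ϖ hϖ Lη hL
  rw [hD]
  exact han hf ϖ hϖ Lη hL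

/-! ### `W = 125400cx1` -/

/-- The kernel ROW CERTIFICATE of `W = 125400cx1` (`[0, 1, 0, 35167, -653037]`): `2`: In* `n = 8`, kind 5 (deep Tate cert), `c = 2` (certified set [2, 4]); `3`: In `n = 5`, kind 1 (split, root witness), `c = 5`; `5`: I0* `n = 6`, kind 5 (deep Tate cert), `c = 2` (certified set [1, 2, 4]); `11`: In `n = 5`, kind 1 (split, root witness), `c = 5`; `19`: In `n = 1`, kind 1 (split, root witness), `c = 1`; complete (`|Δ| = ∏ ℓⁿ`).
Engine `tam.py` (rank-2 observatory) unmodified; checked by `decide +kernel`. [cite: SilvermanATAEC1994, IV.9.4] [cite: Cremona1997, Table 1 (label 125400cx1)] -/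
theorem rowCheck_v125400cx1 : TamLocal.rowCheck [⟨2, 1, 5, 0, 3, 0, 2, 8, 71, 0, 2⟩, ⟨3, 1, 1, 2, 0, 0, 0, 5, 0, 0, 5⟩, ⟨5, 2, 5, 0, 3, 0, 0, 6, 6, 0, 2⟩, ⟨11, 3, 1, 10, 0, 0, 0, 5, 0, 0, 5⟩, ⟨19, 4, 1, 12, 0, 0, 0, 1, 0, 0, 1⟩] ⟨0, 1, 0, 35167, (-653037)⟩ = true := by
  decide +kernel

set_option maxRecDepth 100000 in
/-- `W = 125400cx1` (`[0, 1, 0, 35167, -653037]`) is a GLOBAL MINIMAL equation (bounded Kraus criterion on the literal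
coefficients). [cite: Kraus1989] [cite: SilvermanAEC2009, VII.1 Remark 1.1] -/
theorem isGloballyMinimal_v125400cx1 : (⟨0, 1, 0, 35167, (-653037)⟩ : WeierstrassCurve ℚ).IsGloballyMinimal :=
  isGloballyMinimal_of_krausCriterion_bounded 0 1 0 35167 (-653037)
    (by decide +kernel) (by decide +kernel) (by decide +kernel)

/-- **(E⁺_η) ∧ (C1⁺_η) at `p = 5` for EVERY tower-onto good supersingular twist of `W = 125400cx1`** (Cremona's minimal
model `[0, 1, 0, 35167, -653037]`, additive `I₀*` at `5`; its minimal `5`-twist `V` has conductor `5016`, good supersingular with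
`a_5(V) = 0`, `ρ_{V,5^∞}` onto, `r_an = 1` — a RANK-ONE TOWER-ONTO row of crux 19601's census; Tamagawa-`5`
primes `3:5, 11:5`, `v_an = 1` in g3's table). IN THE KERNEL: `Δ ≠ 0`, global minimality, the local Tamagawa
numbers of `W` at every bad prime (`rowCheck_v125400cx1`), hence `∑_T ord₅ c_ℓ(W) = 2` on `T = {3, 11}` and
`5 ∤ c_ℓ(W)` at every other `ℓ ≠ 5`. DISPLAYED: `rank W(ℚ) ≤ 1`; on `V`: tower onto, the `V`-certificate,
the analytic certificate `25 ∤ coeff₁ L_5⁺(V,η,T)`. CONDITIONAL on the named facts; a per-row instance; nothing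
booked; `BSD(W,5)` not claimed. [cite: Kobayashi2003, §4 Even main conjecture and Thm. 4.1 (p. 8)]
[cite: KitajimaOtsuki2018, Thm. 1.3] [cite: MilneADT2006, Ch. I, Thm. 4.10] [cite: Cremona1997, Table 1 (label 125400cx1)] -/
theorem etaPair_r1_v125400cx1_5
    (h12 : Kobayashi2003.thm12_signedSelmerDual_finite_torsion)
    (h13 : Kobayashi2003.thm41_signedCharIdeal_divisibility)
    (h22 : Kobayashi2003.thm22_etaSignedSelmerDual_finite_torsion)
    (h41 : Kobayashi2003.thm41_plusEtaCharIdeal_dvd)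
    (hKO : KitajimaOtsuki2018.mainThm13_etaSignedSelmerDual_noFiniteSubmodule)
    (hPT : poitouTate_selmerStructure_duality_real ℚ)
    (W : WeierstrassCurve ℚ) (hW : W = ⟨0, 1, 0, 35167, (-653037)⟩)
    (hrW : W.mordellWeilRank ≤ 1)
    (V : WeierstrassCurve ℚ) [V.IsElliptic] [V.IsGloballyMinimal] [Fact (5 : ℕ).Prime]
    (C : VariableChange ℚ) (hCV : C • W.quadraticTwist 5 = V)
    (hgood : V.HasGoodReductionAtPrime 5) (hap : V.frobeniusTrace 5 = 0)
    (hsurj : ∀ m : ℕ, V.HasSurjectiveModNGaloisRep (5 ^ m : ℕ))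
    (hcertV : ∀ {N : ℕ} [NeZero N] (f : CuspForm (Gamma0 N) 2), IsNewformOf V f →
      ∃ L : IwasawaAlgebra 5, Kobayashi2003.IsSignedPAdicLFunction f 5 1 L ∧
        IsUnit (PowerSeries.coeff V.mordellWeilRank L))
    (han : ∀ {N : ℕ} [NeZero N] {f : CuspForm (Gamma0 N) 2}, IsNewformOf V f →
      ∀ (ϖ : ℚ), (if Even (5 / 2) then (ϖ : ℝ) * V.realPeriodRat = plusPeriod f
          else (ϖ : ℝ) * V.imaginaryPeriodRat = minusPeriod f) →
      ∀ (Lη : IwasawaAlgebra 5), IsQuadraticBranchPlusLFunction f 5 ϖ Lη →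
        ¬ (5 : ℤ_[5]) ^ 2 ∣ PowerSeries.coeff (V.quadraticTwist 5).mordellWeilRank Lη) :
    QuadraticBranchPlusEtaLowerInclusionAt V 5 ∧ QuadraticBranchPlusEtaMainConjectureAt V 5 := by
  subst hW
  have hb := IntModelTam.baseChange_rat_mk_int 0 1 0 35167 (-653037)
  haveI : ((⟨0, 1, 0, 35167, (-653037)⟩ : WeierstrassCurve ℤ).baseChange ℚ).IsElliptic := TamLocal.isElliptic_of_rowCheck rowCheck_v125400cx1
  haveI : ((⟨0, 1, 0, 35167, (-653037)⟩ : WeierstrassCurve ℤ).baseChange ℚ).IsGloballyMinimal := by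
    rw [hb]; exact isGloballyMinimal_v125400cx1
  have hD : ((-1 : ℚ) ^ ((5 : ℕ) / 2) * ((5 : ℕ) : ℚ)) = 5 := by norm_num
  refine etaPair_of_rowCheck_of_tamagawaPair h12 h13 h22 h41 hKO hPT (le_refl 5) rowCheck_v125400cx1
    [3, 11] (by decide) (by decide) (by decide) (by decide) (by decide) rfl (hrW := by rw [hb]; exact hrW) V C
    (by rw [hb, hD]; exact hCV) hgood hap hsurj (fun f hf => hcertV f hf) ?_
  intro N _ f hf ϖ hϖ Lη hL
  rw [hD]
  exact han hf ϖ hϖ Lη hL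

end Summit.BirchSwinnertonDyer.BirchSwinnertonDyer.Theorems.PlusEtaR1TamagawaRows

end
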